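import Literature.Analysis.FluidPDE.NSLerayHopfSereginStability
import Literature.Analysis.FluidPDE.NSLerayHopfSereginWeakTrace
import Literature.Analysis.FluidPDE.LocalLerayWeakTrace
import Literature.Analysis.FluidPDE.LocalLerayViscosityScaling
import Literature.Analysis.FluidPDE.MildL3RestartAveraging
import HarnessLib

/-!
# Seregin's theorem: the current leaves of the decomposition (`seregin_blowup_profile` from
E, W, K₃, L, B; `seregin_L3_blowup_mild` with Thm. 15.1 (C) and Thm. 15.4 in addition)

Analysis/FluidPDE proof file (no new definitions, no new named facts): the state of the DAG of the
tree's decomposition of Seregin's theorem (Lemarié-Rieusset 2016, Thm. 15.5, PDF pp. 570–573 of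
doi:10.1201/b19556 = Seregin 2012, Comm. Math. Phys. 312, Thm. 1.1), obtained by composing the
proved reductions with the discharged inputs:

* `mild_L3_restart` is proved (`mild_L3_restart_holds`, `MildL3RestartAveraging.lean`);
* `leray_solution_weak_trace` is proved (`leray_solution_weak_trace_holds` below, from
  `IsLocalLeraySolution.exists_weak_trace`, `LocalLerayWeakTrace.lean`: weak traces in `L²_loc` of
  local Leray solutions at every positive time);
* `leray_solution_exists_ae_eq_kato` ← **E** `leray_solution_exists_of_memLp_three`,
  **W** `leray_solution_ae_eq_kato` (`leray_solution_exists_ae_eq_kato_of_leray_theory`,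
  `LocalLerayViscosityScaling.lean`);
* `kato_trace_memLp_three` ← `leray_solution_exists_ae_eq_kato`, `leray_solution_weak_trace`
  (`kato_trace_memLp_three_of_weak_trace`, `NSLerayHopfSereginWeakTrace.lean`), hence ← **E**, **W**
  (`kato_trace_memLp_three_of_leray_theory` below; the sibling route of
  `NSLerayHopfSereginTraceProofs.lean` through the Riesz representation theorem
  `riesz_L3_of_testField_bound` is thereby bypassed);
* `leray_solution_L3_weak_stability` ← **K₃** `jia_sverak_leray_weak_stability`,
  **L** `rusin_sverak_stability_of_singularities`,
  **B** `isRegularPoint_of_eLpNorm_parabolicCylinder_lt_top`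
  (`leray_solution_L3_weak_stability_of_compactness`, `NSLerayHopfSereginStability.lean`);
* `seregin_blowup_profile` ← the previous three and `mild_L3_restart`
  (`seregin_blowup_profile_of_facts`, `NSLerayHopfSereginProfileProofs.lean`).

Hence (this file) `seregin_blowup_profile_of_leray_theory : E → W → K₃ → L → B →
seregin_blowup_profile`, and, with `lemarieRieusset_backward_uniqueness` (Thm. 15.4) and
`lemarieRieusset_singular_point_of_blowup` (Thm. 15.1 (C)), the corresponding forms of
`seregin_regular_of_liminf_L3` and of `seregin_L3_blowup_mild` (through which **ns.S08**
`seregin_L3_blowup` is proved). The five remaining named facts are results of the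
Caffarelli–Kohn–Nirenberg / Lemarié-Rieusset / Jia–Šverák local theory at unit viscosity
(**E**: existence of local Leray solutions for `L³` data; **W**: weak–strong uniqueness; **K₃**:
`L³` compactness with traces; **L**: stability of singularities; **B**: backward-cylinder
regularity).

## References

* P. G. Lemarié-Rieusset, *The Navier–Stokes Problem in the 21st Century* (2016),
  doi:10.1201/b19556, Thm. 15.5 and its proof, PDF pp. 570–573; Thm. 15.4; Thm. 15.1 (C).
* G. Seregin, Comm. Math. Phys. 312 (2012) = arXiv:1104.3615, Thm. 1.1.
* H. Jia, V. Šverák, SIAM J. Math. Anal. 45 (2013) = arXiv:1201.1592, proof of Thm. 1.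
* K. Kang, H. Miura, T.-P. Tsai, IMRN 2021 = arXiv:1812.10509, Def. 3.1 (6), Lemma 3.4.
-/

noncomputable section

open MeasureTheory Filter Topology

namespace Literature.Analysis.FluidPDE

/-- **Discharge of `leray_solution_weak_trace`** (`NSLerayHopfSereginWeakTrace.lean`;
Kang–Miura–Tsai 2021, Def. 3.1 (6) with the remark after it and Lemma 3.4; Lemarié-Rieusset 2016,
p. 568): `IsLocalLeraySolution.exists_weak_trace` (`LocalLerayWeakTrace.lean`).
[cite: KangMiuraTsai2020, Def. 3.1 (6) with the remark after Def. 3.1, and Lemma 3.4] -/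
theorem leray_solution_weak_trace_holds : leray_solution_weak_trace :=
  fun _hν _ _ _ _hv₀ _hdiv hv _T hT => hv.exists_weak_trace hT

/-- **`kato_trace_memLp_three` from E and W alone** (Lemarié-Rieusset 2016, p. 573: the `L³`
trace of a Kato solution at the final time under a `liminf` bound): `kato_trace_memLp_three_of_weak_trace`
with `leray_solution_exists_ae_eq_kato_of_leray_theory` and the discharged
`leray_solution_weak_trace_holds`. [cite: LemarieRieusset2016, proof of Thm. 15.5, p. 573] -/
theorem kato_trace_memLp_three_of_leray_theory (hE : leray_solution_exists_of_memLp_three)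
    (hW : leray_solution_ae_eq_kato) : kato_trace_memLp_three :=
  kato_trace_memLp_three_of_weak_trace (leray_solution_exists_ae_eq_kato_of_leray_theory hE hW)
    leray_solution_weak_trace_holds

/-- **The blow-up profile (`seregin_blowup_profile`, steps (1)–(5) of the proof of
Lemarié-Rieusset 2016, Thm. 15.5) from the leaves E, W, K₃, L, B**:
`seregin_blowup_profile_of_facts` with `mild_L3_restart_holds`,
`leray_solution_exists_ae_eq_kato_of_leray_theory`, `kato_trace_memLp_three_of_leray_theory` and
`leray_solution_L3_weak_stability_of_compactness`.
[cite: LemarieRieusset2016, proof of Thm. 15.5, pp. 570–573] [cite: JiaSverak2013, proof of Thm. 1] -/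
theorem seregin_blowup_profile_of_leray_theory (hE : leray_solution_exists_of_memLp_three)
    (hW : leray_solution_ae_eq_kato) (hK : jia_sverak_leray_weak_stability)
    (hL : rusin_sverak_stability_of_singularities)
    (hB : isRegularPoint_of_eLpNorm_parabolicCylinder_lt_top) : seregin_blowup_profile :=
  seregin_blowup_profile_of_facts mild_L3_restart_holds
    (leray_solution_exists_ae_eq_kato_of_leray_theory hE hW)
    (kato_trace_memLp_three_of_leray_theory hE hW)
    (leray_solution_L3_weak_stability_of_compactness hK hL hB)

/-- **Seregin's theorem, core form (`seregin_regular_of_liminf_L3`), from the leaves E, W, K₃,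
L, B and backward uniqueness (Thm. 15.4)**: `seregin_regular_of_liminf_L3_of_profile` with
`seregin_blowup_profile_of_leray_theory`. [cite: LemarieRieusset2016, proof of Thm. 15.5, pp. 570–573] -/
theorem seregin_regular_of_liminf_L3_of_leaves (hE : leray_solution_exists_of_memLp_three)
    (hW : leray_solution_ae_eq_kato) (hK : jia_sverak_leray_weak_stability)
    (hL : rusin_sverak_stability_of_singularities)
    (hB : isRegularPoint_of_eLpNorm_parabolicCylinder_lt_top)
    (hBU : lemarieRieusset_backward_uniqueness) : seregin_regular_of_liminf_L3 :=
  seregin_regular_of_liminf_L3_of_profile (seregin_blowup_profile_of_leray_theory hE hW hK hL hB)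
    hBU

/-- **Lemarié-Rieusset 2016, Thm. 15.5 (`seregin_L3_blowup_mild`, through which ns.S08
`seregin_L3_blowup` is proved) from Thm. 15.1 (C), the leaves E, W, K₃, L, B and Thm. 15.4**:
`seregin_L3_blowup_mild_of_profile` with `seregin_blowup_profile_of_leray_theory`.
[cite: LemarieRieusset2016, Thm. 15.5 and its proof, pp. 570–573] -/
theorem seregin_L3_blowup_mild_of_leaves (h1 : lemarieRieusset_singular_point_of_blowup)
    (hE : leray_solution_exists_of_memLp_three) (hW : leray_solution_ae_eq_kato)
    (hK : jia_sverak_leray_weak_stability) (hL : rusin_sverak_stability_of_singularities)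
    (hB : isRegularPoint_of_eLpNorm_parabolicCylinder_lt_top)
    (hBU : lemarieRieusset_backward_uniqueness) : seregin_L3_blowup_mild :=
  seregin_L3_blowup_mild_of_profile h1 (seregin_blowup_profile_of_leray_theory hE hW hK hL hB) hBU

end Literature.Analysis.FluidPDE

end
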